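import Literature.Algebra.Homology.TotalQuasiIsoOfColumns
import HarnessLib

/-!
# A cochain complex as a one-row bicomplex, and the isomorphism `L ≅ Tot(L[0])` (Weibel 1.2.6; Stacks 012Z)

Layer `Literature/Algebra/Homology` (constructions + proved lemmas; 0 named facts, no instance, no notation; pure homological
algebra in an abelian category `C` in which the total complexes of `ℤ × ℤ`-bicomplexes exist). A cochain complex `L` is viewed as
the bicomplex `L[0]` with columns `Lᵃ[0]` (the object `Lᵃ` in inner degree `0`; outer differential `d_L`, inner differential `0`):

* `singleRowFunctor C : CochainComplex C ℤ ⥤ HomologicalComplex₂ C (up ℤ) (up ℤ)` (Mathlib's `single C (up ℤ) 0` applied termwise,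
  `Functor.mapHomologicalComplex`), `singleRowBicomplex L = (singleRowFunctor C).obj L`; the vanishing `isZero_singleRowBicomplex_X_X`
  off the row `b = 0` and the amplitude lemmas `isStrictlyGE/LE_singleRowBicomplex(_X)`;
* `ιTotalSingleRowF L n : Lⁿ ⟶ Tot(L[0])ⁿ` (`= (Lⁿ[0])⁰ ⟶ ∐_{a+b=n} (Lᵃ[0])ᵇ`, the summand `(n, 0)`), an isomorphism because all
  other summands vanish (`TotalQuasiIsoOfColumns.isIso_ιTotal_of_isZero`);
* **`ιTotalSingleRow L : L ⟶ (singleRowBicomplex L).total (up ℤ)`** — a chain map (the sign `ε₁ = 1` of Mathlib's total complex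
  on the horizontal differential) and an ISOMORPHISM (`isIso_ιTotalSingleRow`, `ιTotalSingleRowIso`), natural in `L`
  (`ιTotalSingleRow_naturality`).

This is the category-generic form of the tree's `Modules/CechOrderedBicomplex` §3–§4 (`CechOrd.singleBicomplex`, `ιTotalSingle`,
`isIso_ιTotalSingleF`, typed there over `X.Modules` for a scheme `X`), usable for `ModuleCat`-valued bicomplexes such as the
ordered Čech bicomplex of a pair-system (`Algebra/Homology/OrderedCechPairSystem`); the one-COLUMN analogue is
`TotalQuasiIsoOfColumns.quasiIso_total_map_single_map_zero_iff`, and `Algebra/Homology/MapBifunctorSingleColumn.columnIso` is the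
bifunctor version — none of them is restated here. Library only (cell `pub-hodge-ring2`, count-neutral); proves nothing about any
crux, route or conjecture. Mathlib searched (pin v4.32): `HomologicalComplex.single`, `singleObjXSelf`, `single_obj_d`,
`single_map_f_self`, `isZero_single_obj_X`, `Functor.mapHomologicalComplex`, `HomologicalComplex₂.ιTotal` / `total_d` / `ι_D₁` /
`ι_D₂` / `d₁_eq` / `d₂_eq'` / `ιTotal_map`, `Hom.isIso_of_components` (used); no generic one-row/one-column bicomplex API.

## References

* C. A. Weibel, *An introduction to homological algebra* (1994), 1.2.6 and Ex. 1.2.8 (total complex; a complex as a double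
  complex concentrated in one row). [Weibel1994]
* The Stacks Project, Tag 012Z (total complex and its signs). [StacksProject]
-/

noncomputable section

-- `GradedObject`/`HomologicalComplex₂.toGradedObject` are not reducible (as in Mathlib's `Algebra/Homology/TotalComplex.lean`).
set_option backward.isDefEq.respectTransparency false

open CategoryTheory CategoryTheory.Category CategoryTheory.Limits HomologicalComplex

universe v u

namespace Literature.Algebra.Homology

variable {C : Type u} [Category.{v} C] [Abelian C]
  [∀ K : HomologicalComplex₂ C (ComplexShape.up ℤ) (ComplexShape.up ℤ), K.HasTotal (ComplexShape.up ℤ)]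

/-! ### §1 The one-row bicomplex `L[0]` -/

variable (C) in
/-- **`L ↦ L[0]`**: a cochain complex as a bicomplex concentrated in inner degree `0` (column `a` is `Lᵃ[0]`), functorially in
`L` — Mathlib's `single C (up ℤ) 0` applied termwise. [cite: Weibel1994, 1.2.6 and Ex. 1.2.8] -/
def singleRowFunctor : CochainComplex C ℤ ⥤ HomologicalComplex₂ C (ComplexShape.up ℤ) (ComplexShape.up ℤ) :=
  (single C (ComplexShape.up ℤ) 0).mapHomologicalComplex (ComplexShape.up ℤ)

/-- The one-row bicomplex `L[0]` of a cochain complex `L`. [cite: Weibel1994, 1.2.6 and Ex. 1.2.8] -/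
abbrev singleRowBicomplex (L : CochainComplex C ℤ) : HomologicalComplex₂ C (ComplexShape.up ℤ) (ComplexShape.up ℤ) :=
  (singleRowFunctor C).obj L

variable (L : CochainComplex C ℤ)

omit [∀ K : HomologicalComplex₂ C (ComplexShape.up ℤ) (ComplexShape.up ℤ), K.HasTotal (ComplexShape.up ℤ)] in
/-- The columns of `L[0]` are the one-term complexes `Lᵃ[0]` (`rfl`). [cite: Weibel1994, 1.2.6] -/
theorem singleRowBicomplex_X (a : ℤ) : (singleRowBicomplex L).X a = (single C (ComplexShape.up ℤ) 0).obj (L.X a) := rfl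

omit [∀ K : HomologicalComplex₂ C (ComplexShape.up ℤ) (ComplexShape.up ℤ), K.HasTotal (ComplexShape.up ℤ)] in
/-- The outer differential of `L[0]` in inner degree `0` is `d_L` (up to `singleObjXSelf`). [cite: Weibel1994, 1.2.6] -/
theorem singleRowBicomplex_d_f_zero (a a' : ℤ) :
    ((singleRowBicomplex L).d a a').f 0 =
      (singleObjXSelf (ComplexShape.up ℤ) 0 (L.X a)).hom ≫ L.d a a' ≫ (singleObjXSelf (ComplexShape.up ℤ) 0 (L.X a')).inv :=
  single_map_f_self _ _ _

omit [∀ K : HomologicalComplex₂ C (ComplexShape.up ℤ) (ComplexShape.up ℤ), K.HasTotal (ComplexShape.up ℤ)] in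
/-- The inner differentials of `L[0]` vanish. [cite: Weibel1994, 1.2.6] -/
theorem singleRowBicomplex_X_d (a b b' : ℤ) : ((singleRowBicomplex L).X a).d b b' = 0 :=
  single_obj_d _ _ _ _ _

omit [∀ K : HomologicalComplex₂ C (ComplexShape.up ℤ) (ComplexShape.up ℤ), K.HasTotal (ComplexShape.up ℤ)] in
/-- `L[0]` vanishes off the row `b = 0`. [cite: Weibel1994, 1.2.6] -/
theorem isZero_singleRowBicomplex_X_X (a b : ℤ) (hb : b ≠ 0) : IsZero (((singleRowBicomplex L).X a).X b) :=
  isZero_single_obj_X _ _ _ _ hb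

omit [∀ K : HomologicalComplex₂ C (ComplexShape.up ℤ) (ComplexShape.up ℤ), K.HasTotal (ComplexShape.up ℤ)] in
/-- Every column of `L[0]` is concentrated in degrees `≥ 0`. [cite: Weibel1994, 1.2.6] -/
theorem isStrictlyGE_singleRowBicomplex_X (a : ℤ) : CochainComplex.IsStrictlyGE ((singleRowBicomplex L).X a) 0 :=
  (CochainComplex.isStrictlyGE_iff _ _).2 fun b hb => isZero_singleRowBicomplex_X_X L a b (by omega)

omit [∀ K : HomologicalComplex₂ C (ComplexShape.up ℤ) (ComplexShape.up ℤ), K.HasTotal (ComplexShape.up ℤ)] in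
/-- Every column of `L[0]` is concentrated in degrees `≤ 0`. [cite: Weibel1994, 1.2.6] -/
theorem isStrictlyLE_singleRowBicomplex_X (a : ℤ) : CochainComplex.IsStrictlyLE ((singleRowBicomplex L).X a) 0 :=
  (CochainComplex.isStrictlyLE_iff _ _).2 fun b hb => isZero_singleRowBicomplex_X_X L a b (by omega)

omit [∀ K : HomologicalComplex₂ C (ComplexShape.up ℤ) (ComplexShape.up ℤ), K.HasTotal (ComplexShape.up ℤ)] in
/-- `L[0]` has columns `≥ a` when `L` is in degrees `≥ a`. [cite: Weibel1994, 1.2.6] -/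
theorem isStrictlyGE_singleRowBicomplex (a : ℤ) [L.IsStrictlyGE a] : CochainComplex.IsStrictlyGE (singleRowBicomplex L) a :=
  (CochainComplex.isStrictlyGE_iff _ _).2 fun i hi =>
    Functor.map_isZero (single C (ComplexShape.up ℤ) 0) (L.isZero_of_isStrictlyGE a i hi)

omit [∀ K : HomologicalComplex₂ C (ComplexShape.up ℤ) (ComplexShape.up ℤ), K.HasTotal (ComplexShape.up ℤ)] in
/-- `L[0]` has columns `≤ b` when `L` is in degrees `≤ b`. [cite: Weibel1994, 1.2.6] -/
theorem isStrictlyLE_singleRowBicomplex (b : ℤ) [L.IsStrictlyLE b] : CochainComplex.IsStrictlyLE (singleRowBicomplex L) b :=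
  (CochainComplex.isStrictlyLE_iff _ _).2 fun i hi =>
    Functor.map_isZero (single C (ComplexShape.up ℤ) 0) (L.isZero_of_isStrictlyLE b i hi)

/-! ### §2 `L ≅ Tot(L[0])` -/

/-- The comparison maps `Lⁿ ≅ (Lⁿ[0])⁰ ⟶ Tot(L[0])ⁿ` (the summand `(n, 0)`). [cite: Weibel1994, 1.2.6 and Ex. 1.2.8] -/
def ιTotalSingleRowF (n : ℤ) : L.X n ⟶ ((singleRowBicomplex L).total (ComplexShape.up ℤ)).X n :=
  (singleObjXSelf (ComplexShape.up ℤ) 0 (L.X n)).inv ≫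
    (singleRowBicomplex L).ιTotal (ComplexShape.up ℤ) n 0 n (add_zero n)

/-- The comparison maps are isomorphisms: all other summands `(Lᵃ[0])ᵇ`, `a + b = n`, `a ≠ n`, of `Tot(L[0])ⁿ` vanish
(`TotalQuasiIsoOfColumns.isIso_ιTotal_of_isZero`). [cite: Weibel1994, 1.2.6 and Ex. 1.2.8] -/
theorem isIso_ιTotalSingleRowF (n : ℤ) : IsIso (ιTotalSingleRowF L n) := by
  haveI : IsIso ((singleRowBicomplex L).ιTotal (ComplexShape.up ℤ) n 0 n (add_zero n)) :=
    isIso_ιTotal_of_isZero _ n 0 n (add_zero n)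
      fun j₁ j₂ hj hj₁ => isZero_singleRowBicomplex_X_X L j₁ j₂ (by omega)
  unfold ιTotalSingleRowF
  infer_instance

/-- **`L ⟶ Tot(L[0])`**, the comparison chain map (no sign: Mathlib's total differential is `d₁ + d₂` with `ε₁ = 1` on the
horizontal part, and `d₂ = 0` here). [cite: Weibel1994, 1.2.6 and Ex. 1.2.8] [cite: StacksProject, Tag 012Z] -/
def ιTotalSingleRow : L ⟶ (singleRowBicomplex L).total (ComplexShape.up ℤ) where
  f n := ιTotalSingleRowF L n
  comm' n m hnm := by
    obtain rfl : n + 1 = m := hnm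
    dsimp only [ιTotalSingleRowF]
    rw [Category.assoc, HomologicalComplex₂.total_d, Preadditive.comp_add, HomologicalComplex₂.ι_D₁,
      HomologicalComplex₂.ι_D₂,
      (singleRowBicomplex L).d₂_eq' (ComplexShape.up ℤ) n (show (ComplexShape.up ℤ).Rel (0 : ℤ) 1 by simp) (n + 1),
      (singleRowBicomplex L).d₁_eq (ComplexShape.up ℤ) (show (ComplexShape.up ℤ).Rel n (n + 1) by simp) 0 (n + 1)
        (add_zero _), singleRowBicomplex_X_d, zero_comp, smul_zero, add_zero, singleRowBicomplex_d_f_zero]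
    change _ ≫ ((1 : ℤˣ) • _) = _
    rw [one_smul]
    simp only [Category.assoc, Iso.inv_hom_id_assoc]

/-- The components of `ιTotalSingleRow` (`rfl`). [cite: Weibel1994, 1.2.6] -/
@[simp] theorem ιTotalSingleRow_f (n : ℤ) : (ιTotalSingleRow L).f n = ιTotalSingleRowF L n := rfl

/-- **`L ⟶ Tot(L[0])` is an isomorphism.** [cite: Weibel1994, 1.2.6 and Ex. 1.2.8] -/
theorem isIso_ιTotalSingleRow : IsIso (ιTotalSingleRow L) := by
  haveI : ∀ n, IsIso ((ιTotalSingleRow L).f n) := fun n => isIso_ιTotalSingleRowF L n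
  exact Hom.isIso_of_components _

/-- **`L ≅ Tot(L[0])`** as an isomorphism of cochain complexes. [cite: Weibel1994, 1.2.6 and Ex. 1.2.8] [cite: StacksProject, Tag 012Z] -/
def ιTotalSingleRowIso : L ≅ (singleRowBicomplex L).total (ComplexShape.up ℤ) :=
  haveI := isIso_ιTotalSingleRow L
  asIso (ιTotalSingleRow L)

/-- The underlying morphism of `ιTotalSingleRowIso` (`rfl`). [cite: Weibel1994, 1.2.6] -/
@[simp] theorem ιTotalSingleRowIso_hom : (ιTotalSingleRowIso L).hom = ιTotalSingleRow L := rfl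

variable {L} in
/-- **Naturality of `L ⟶ Tot(L[0])` in `L`.** [cite: Weibel1994, 1.2.6 and Ex. 1.2.8] -/
theorem ιTotalSingleRow_naturality {L' : CochainComplex C ℤ} (φ : L ⟶ L') :
    φ ≫ ιTotalSingleRow L' =
      ιTotalSingleRow L ≫ HomologicalComplex₂.total.map ((singleRowFunctor C).map φ) (ComplexShape.up ℤ) := by
  ext n
  have h : (((singleRowFunctor C).map φ).f n).f 0 = (singleObjXSelf (ComplexShape.up ℤ) 0 (L.X n)).hom ≫
      φ.f n ≫ (singleObjXSelf (ComplexShape.up ℤ) 0 (L'.X n)).inv :=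
    single_map_f_self _ _ _
  rw [comp_f, comp_f, ιTotalSingleRow_f, ιTotalSingleRow_f]
  unfold ιTotalSingleRowF
  rw [Category.assoc, HomologicalComplex₂.ιTotal_map, h]
  simp only [Category.assoc, Iso.inv_hom_id_assoc]

end Literature.Algebra.Homology

end
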